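import Literature.AlgebraicGeometry.Motives.HodgeStructureLefschetzGroupDirectSumPoints
import HarnessLib

/-!
# Milne 1999, Definition 4.6 and Corollary 4.7 ON `K`-POINTS for the abstract polarized `ℚ`-Hodge structure, in the
# `G(A)`-avatar of Theorem 4.4: `G(H₁ ⊕ H₂)(K)` is the FIBRE PRODUCT of `(G(H₁)(K), l₁)` and `(G(H₂)(K), l₂)` over `K^×`
# when `Hom(H₁, H₂) = 0 = Hom(H₂, H₁)`, and `G(H ⊕ H)(K) = Δ G(H)(K)`

[topic AlgebraicGeometry/Motives]

Layer `Literature/AlgebraicGeometry/Motives`, lane `lit-hodgefound` (Track 2 foundations library; seat `lit-hodgefound-p34`,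
generation 19, self-proposed row g19-#3 of `run/shared/lean/pub/lit-hodgefound/SKELETON.md`). Two definitions WITH BODIES (the
fibre product of Definition 4.6 on `K`-points, `Polarization.lefschetzSimilitudeGroupBaseChangeFibreProd`, and the isomorphism of
Corollary 4.7 on `K`-points, `Polarization.lefschetzSimilitudeGroupBaseChangeFibreProdMulEquiv`) and THEOREMS; no named fact
(net debt `0`). It is the `G`-companion of the seat's g18-#5 `Motives/HodgeStructureLefschetzGroupDirectSumPoints` (Proposition 1.5
on `K`-points for `S`): CARRIER two pure `ℚ`-Hodge structures `H₁, H₂` of the same weight with polarizations `Q₁, Q₂`, the direct sum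
`H₁ ⊕ H₂ = H₁.prod H₂` with the product polarization `Q₁.prod Q₂` (`Motives/HodgeStructureProdPolarization`), a field `K ⊇ ℚ`, and
Milne's `G(A)(K)` in the tree's form `G(H)(K) = Polarization.lefschetzSimilitudeGroupBaseChange K Q ≤ GL(K ⊗_ℚ V)` (g18-#1
`Motives/HodgeStructureLefschetzGroupPoints`: the `γ` commuting with every `a_K`, `a ∈ E_φ`, with `Q_K(γx, γy) = ν · Q_K(x, y)` for
some `ν ≠ 0` — the multiplier `l(γ) = γ†γ`). By Theorem 4.4 (`γ ↦ (γ, γ†γ) : G(A) ⥲ L(A)`, the seat's g19-#1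
`Motives/HodgeStructureExtendedLefschetzGroupPoints`, not imported) every statement below about `(G, l)` is the corresponding
statement about `(L(A), l(A))`.

## The source, verbatim

J. S. Milne, *Lefschetz classes on abelian varieties*, Duke Math. J. **96** (1999) 639–675 [Milne1999LefschetzClasses]
(held `paper:doi-10-1215-s0012-7094-99-09620-5`, author's folios p0021 L35–L49, p0022 L5–L24; Duke pp. 659–660):
* "**Definition 4.6.** Consider a family `(Gᵢ, tᵢ)_{i ∈ I}` of pairs consisting of an algebraic group `Gᵢ` over `k` and a
  homomorphism `tᵢ : Gᵢ → 𝔾_m`. We define the product `∏(Gᵢ, tᵢ)` of the family to be the pair `(G, t)` consisting of the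
  largest subgroup of `∏ Gᵢ` on which the characters `(gᵢ)_{i∈I} ↦ t_{i₀}(g_{i₀})` agree and of the common restriction of these
  characters to `G`. It is universal with respect to the maps `(G, t) → (Gᵢ, tᵢ)`."
* "**Corollary 4.7.** An isogeny `A → A₁^{r₁} × ⋯ × A_s^{r_s}` with the `Aᵢ` simple and pairwise nonisogenous defines an
  isomorphism `(L(A), l(A)) → ∏_{i=1}^{s} (L(Aᵢ), l(Aᵢ))`, which is independent of the choice of the isogeny. *Proof.* Let
  `(L, l) = ∏(L(Aᵢ), l(Aᵢ))`, and consider the diagram `0 → S(A) → L(A) → 𝔾_m → 0` over `0 → ∏ S(Aᵢ) → L → 𝔾_m → 0`. Because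
  two of the vertical maps are isomorphisms, so also is the third."
* §4 p0021 L10–L15 (p. 659): "`G(A)(R) = {γ ∈ C(A) ⊗ R | γ†γ ∈ R^×}` […] **Theorem 4.4.** The map `γ ↦ (γ, γ†γ): G(A) →
  GL(V(A)) × 𝔾_m` sends `G(A)` isomorphically onto `L(A)`"; §1 Prop. 1.5 / Prop. 1.1 (p. 643–644: `C(A) ⊂ C(A₁) × ⋯ × C(A_s)`
  with equality iff `Hom(Aᵢ, Aⱼ) = 0`), §3 p. 654 ("`S(A) = S(A^r)`"), Remark 1.6 (extension of the coefficient field).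
* B. Moonen, *An introduction to Mumford–Tate groups* (2004) [Moonen2004MT], §4 Lemma 4.6 (automorphisms of `V₁ ⊕ V₂` commuting
  with the projectors; the tree's `restrictRetract`, `blockDiag`).

## What is PROVED (binary direct sums, `K`-points for every field `K ⊇ ℚ`)

* §1 **Definition 4.6 on `K`-points** (`s = 2`): `Polarization.lefschetzSimilitudeGroupBaseChangeFibreProd K Q₁ Q₂ ≤ GL(K ⊗ V₁) ×
  GL(K ⊗ V₂)`, the pairs `(γ₁, γ₂)` with `γᵢ` commuting with `E_φ(Hᵢ) ⊗ K` and a COMMON multiplier `ν ≠ 0`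
  (`Qᵢ,K(γᵢ x, γᵢ y) = ν Qᵢ,K(x, y)`); it lies in `G(H₁)(K) × G(H₂)(K)` (`…FibreProd_le_prod`) and contains `S(H₁)(K) × S(H₂)(K)`
  (`prod_lefschetzGroupBaseChange_le_…FibreProd`, the kernel of the common character).
* §2 **`G(H₁ ⊕ H₂)(K) ⊆` the fibre product** (block-diagonality, exactly as for `S`): the blocks `pr₁ γ in₁`, `pr₂ γ in₂` of
  `γ ∈ G(H₁ ⊕ H₂)(K)` form a pair of the fibre product WITH THE MULTIPLIER OF `γ`
  (`restrictRetract_pair_mem_lefschetzSimilitudeGroupBaseChangeFibreProd`), `γ` is their block sum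
  (`eq_blockDiag_of_mem_lefschetzSimilitudeGroupBaseChange_prod`), hence
  **`lefschetzSimilitudeGroupBaseChange_prod_le_map_blockDiag`**.
* §3 **the common character**: for `γ₁ ⊕ γ₂` the multiplier clause for `Q₁ ⊕ Q₂` with `ν` is equivalent to the two clauses with
  the same `ν` (`forall_baseChange_prod_form_blockDiag_iff` — "the common restriction of these characters"); **`γ₁ ⊕ γ₂ ∈
  G(H₁ ⊕ H₂)(K)` exactly** iff `(γ₁, γ₂)` is in the fibre product and intertwines every morphism between the summands
  (`blockDiag_mem_lefschetzSimilitudeGroupBaseChange_prod_iff`).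
* §4 **Corollary 4.7 on `K`-points (`s = 2`)**: `blockDiag` maps the whole fibre product into `G(H₁ ⊕ H₂)(K)` iff
  `Hom(H₁, H₂) = 0 = Hom(H₂, H₁)` (`forall_blockDiag_mem_lefschetzSimilitudeGroupBaseChange_prod_iff`); then
  **`lefschetzSimilitudeGroupBaseChange_prod_eq_map_blockDiag_of_hom_eq_zero : G(H₁ ⊕ H₂)(K) = (fibre product).map blockDiag`**
  and the isomorphism **`Polarization.lefschetzSimilitudeGroupBaseChangeFibreProdMulEquiv : (fibre product) ≃* G(H₁ ⊕ H₂)(K)`**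
  (`γ ↦ γ₁ ⊕ γ₂`; `blockDiag` is injective).
* §5 **powers (`r = 2`)**: `γ₁ ⊕ γ₂ ∈ G(H ⊕ H)(K) ⟺ γ₁ = γ₂ ∈ G(H)(K)`, `G(H ⊕ H)(K) = Δ G(H)(K)`
  (`lefschetzSimilitudeGroupBaseChange_prod_self_eq_map_diagEmbedding`) — "`L(A^r) = L(A)`".

NOT here: `s > 2` / `r > 2` (iterate), the isogeny clause, the algebraic groups themselves (only `K`-points, as everywhere in the
lane), and the translation to `(L(A), l(A)) ⊂ GL × 𝔾_m` (Theorem 4.4 on points is g19-#1, BY NAME).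

## References

* [Milne1999LefschetzClasses] J. S. Milne, *Lefschetz classes on abelian varieties*, Duke Math. J. 96 (1999) 639–675, §4
  Definition 4.6, Corollary 4.7 (pp. 659–660), Theorem 4.4; §1 Prop. 1.1, Prop. 1.5, Remark 1.6; §3 p. 654.
* [Moonen2004MT] B. Moonen, *An introduction to Mumford–Tate groups* (2004), §4 Lemma 4.6.
* [DeligneHodgeII1971] P. Deligne, *Théorie de Hodge II*, Publ. Math. IHÉS 40 (1971), 2.1, 2.1.15 (direct sums, the product
  polarization).
* [BourbakiAlgebraI1989] N. Bourbaki, *Algebra I*, Ch. II §5 no. 3 Prop. 7 (extension of scalars is faithful over a field).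
-/

noncomputable section

open TensorProduct

namespace Literature.AlgebraicGeometry.Motives

namespace HodgeStructure

universe u uK

variable (K : Type uK) [Field K] [Algebra ℚ K]
  {V₁ : Type u} [AddCommGroup V₁] [Module ℚ V₁] {V₂ : Type u} [AddCommGroup V₂] [Module ℚ V₂] {n : ℤ}
  {H₁ : HodgeStructure V₁ n} {H₂ : HodgeStructure V₂ n} (Q₁ : Polarization H₁) (Q₂ : Polarization H₂)

/-! ## §0 Plumbing: the base-changed retract identities on `V₁ ⊕ V₂` -/

section Plumbing

/-- `fst_K (inl_K x) = x`. Private plumbing. [folklore] -/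
private theorem fst_inl_pt (x : K ⊗[ℚ] V₁) :
    (LinearMap.fst ℚ V₁ V₂).baseChange K ((LinearMap.inl ℚ V₁ V₂).baseChange K x) = x :=
  baseChange_retract_apply K (ι := LinearMap.inl ℚ V₁ V₂) (π := LinearMap.fst ℚ V₁ V₂) (fun _ ↦ rfl) x

/-- `snd_K (inr_K y) = y`. Private plumbing. [folklore] -/
private theorem snd_inr_pt (y : K ⊗[ℚ] V₂) :
    (LinearMap.snd ℚ V₁ V₂).baseChange K ((LinearMap.inr ℚ V₁ V₂).baseChange K y) = y :=
  baseChange_retract_apply K (ι := LinearMap.inr ℚ V₁ V₂) (π := LinearMap.snd ℚ V₁ V₂) (fun _ ↦ rfl) y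

/-- `snd_K (inl_K x) = 0`. Private plumbing. [folklore] -/
private theorem snd_inl_pt (x : K ⊗[ℚ] V₁) :
    (LinearMap.snd ℚ V₁ V₂).baseChange K ((LinearMap.inl ℚ V₁ V₂).baseChange K x) = 0 := by
  rw [← LinearMap.comp_apply, ← LinearMap.baseChange_comp, LinearMap.snd_comp_inl, LinearMap.baseChange_zero,
    LinearMap.zero_apply]

/-- `fst_K (inr_K y) = 0`. Private plumbing. [folklore] -/
private theorem fst_inr_pt (y : K ⊗[ℚ] V₂) :
    (LinearMap.fst ℚ V₁ V₂).baseChange K ((LinearMap.inr ℚ V₁ V₂).baseChange K y) = 0 := by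
  rw [← LinearMap.comp_apply, ← LinearMap.baseChange_comp, LinearMap.fst_comp_inr, LinearMap.baseChange_zero,
    LinearMap.zero_apply]

/-- `inl_K (fst_K z) + inr_K (snd_K z) = z`. Private plumbing. [folklore] -/
private theorem inl_fst_add_inr_snd_pt (z : K ⊗[ℚ] (V₁ × V₂)) :
    (LinearMap.inl ℚ V₁ V₂).baseChange K ((LinearMap.fst ℚ V₁ V₂).baseChange K z) +
        (LinearMap.inr ℚ V₁ V₂).baseChange K ((LinearMap.snd ℚ V₁ V₂).baseChange K z) = z := by
  rw [← LinearMap.comp_apply, ← LinearMap.baseChange_comp, ← LinearMap.comp_apply, ← LinearMap.baseChange_comp,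
    ← LinearMap.add_apply, ← LinearMap.baseChange_add]
  have : LinearMap.inl ℚ V₁ V₂ ∘ₗ LinearMap.fst ℚ V₁ V₂ + LinearMap.inr ℚ V₁ V₂ ∘ₗ LinearMap.snd ℚ V₁ V₂ = LinearMap.id := by
    ext <;> simp
  rw [this, LinearMap.baseChange_id, LinearMap.id_apply]

/-- `a_K (inl_K x)` through the blocks of `a`. Private plumbing. [folklore] -/
private theorem baseChange_apply_inl_pt (a : Module.End ℚ (V₁ × V₂)) (x : K ⊗[ℚ] V₁) :
    a.baseChange K ((LinearMap.inl ℚ V₁ V₂).baseChange K x) =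
      (LinearMap.inl ℚ V₁ V₂).baseChange K ((LinearMap.fst ℚ V₁ V₂ ∘ₗ a ∘ₗ LinearMap.inl ℚ V₁ V₂).baseChange K x) +
        (LinearMap.inr ℚ V₁ V₂).baseChange K ((LinearMap.snd ℚ V₁ V₂ ∘ₗ a ∘ₗ LinearMap.inl ℚ V₁ V₂).baseChange K x) := by
  simp only [LinearMap.baseChange_comp, LinearMap.coe_comp, Function.comp_apply]
  exact (inl_fst_add_inr_snd_pt K _).symm

/-- `a_K (inr_K y)` through the blocks of `a`. Private plumbing. [folklore] -/
private theorem baseChange_apply_inr_pt (a : Module.End ℚ (V₁ × V₂)) (y : K ⊗[ℚ] V₂) :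
    a.baseChange K ((LinearMap.inr ℚ V₁ V₂).baseChange K y) =
      (LinearMap.inl ℚ V₁ V₂).baseChange K ((LinearMap.fst ℚ V₁ V₂ ∘ₗ a ∘ₗ LinearMap.inr ℚ V₁ V₂).baseChange K y) +
        (LinearMap.inr ℚ V₁ V₂).baseChange K ((LinearMap.snd ℚ V₁ V₂ ∘ₗ a ∘ₗ LinearMap.inr ℚ V₁ V₂).baseChange K y) := by
  simp only [LinearMap.baseChange_comp, LinearMap.coe_comp, Function.comp_apply]
  exact (inl_fst_add_inr_snd_pt K _).symm

/-- An automorphism and its inverse in `GL(W)`: `γ (γ⁻¹ x) = x`. Private plumbing. [folklore] -/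
private theorem gl_apply_inv_apply_pt {R : Type*} [CommSemiring R] {W : Type*} [AddCommMonoid W] [Module R W]
    (γ : W ≃ₗ[R] W) (x : W) : γ (γ⁻¹ x) = x :=
  γ.apply_symm_apply x

end Plumbing

/-! ## §1 Definition 4.6 on `K`-points: the fibre product of `(G(H₁)(K), l₁)` and `(G(H₂)(K), l₂)` over `K^×` -/

section FibreProd

/-- **Milne's product `(G(H₁), l₁) × (G(H₂), l₂)` of Definition 4.6, on `K`-points**: the subgroup of
`GL(K ⊗ V₁) × GL(K ⊗ V₂)` of the pairs `(γ₁, γ₂)` with `γᵢ` commuting with every `a_K`, `a ∈ E_φ(Hᵢ)`, "on which the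
characters agree": ONE `ν ≠ 0` with `Q₁,K(γ₁ x, γ₁ y) = ν Q₁,K(x, y)` and `Q₂,K(γ₂ x, γ₂ y) = ν Q₂,K(x, y)` (so `γᵢ ∈ G(Hᵢ)(K)`
with `l₁(γ₁) = l₂(γ₂)`). [cite: Milne1999LefschetzClasses, §4 Definition 4.6 (p. 659)] -/
def Polarization.lefschetzSimilitudeGroupBaseChangeFibreProd :
    Subgroup (((K ⊗[ℚ] V₁) ≃ₗ[K] (K ⊗[ℚ] V₁)) × ((K ⊗[ℚ] V₂) ≃ₗ[K] (K ⊗[ℚ] V₂))) where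
  carrier := {p |
    (∀ a : H₁.endAlg, ∀ x, (a : Module.End ℚ V₁).baseChange K (p.1 x) = p.1 ((a : Module.End ℚ V₁).baseChange K x)) ∧
      (∀ b : H₂.endAlg, ∀ y, (b : Module.End ℚ V₂).baseChange K (p.2 y) = p.2 ((b : Module.End ℚ V₂).baseChange K y)) ∧
        ∃ ν : K, ν ≠ 0 ∧ (∀ x y, Q₁.form.baseChange K (p.1 x) (p.1 y) = ν * Q₁.form.baseChange K x y) ∧
          ∀ x y, Q₂.form.baseChange K (p.2 x) (p.2 y) = ν * Q₂.form.baseChange K x y}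
  one_mem' := ⟨fun _ _ ↦ rfl, fun _ _ ↦ rfl, 1, one_ne_zero, fun _ _ ↦ (one_mul _).symm, fun _ _ ↦ (one_mul _).symm⟩
  mul_mem' {p p'} hp hp' := by
    obtain ⟨ν, hν, h₁, h₂⟩ := hp.2.2
    obtain ⟨ν', hν', h₁', h₂'⟩ := hp'.2.2
    exact ⟨fun a x ↦ by rw [Prod.fst_mul, LinearEquiv.mul_apply, LinearEquiv.mul_apply, hp.1 a, hp'.1 a],
      fun b y ↦ by rw [Prod.snd_mul, LinearEquiv.mul_apply, LinearEquiv.mul_apply, hp.2.1 b, hp'.2.1 b],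
      ν * ν', mul_ne_zero hν hν',
      fun x y ↦ by rw [Prod.fst_mul, LinearEquiv.mul_apply, LinearEquiv.mul_apply, h₁, h₁', mul_assoc],
      fun x y ↦ by rw [Prod.snd_mul, LinearEquiv.mul_apply, LinearEquiv.mul_apply, h₂, h₂', mul_assoc]⟩
  inv_mem' {p} hp := by
    obtain ⟨ν, hν, h₁, h₂⟩ := hp.2.2
    refine ⟨fun a x ↦ p.1.injective (by rw [Prod.fst_inv, gl_apply_inv_apply_pt, ← hp.1 a, gl_apply_inv_apply_pt]),
      fun b y ↦ p.2.injective (by rw [Prod.snd_inv, gl_apply_inv_apply_pt, ← hp.2.1 b, gl_apply_inv_apply_pt]),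
      ν⁻¹, inv_ne_zero hν, fun x y ↦ ?_, fun x y ↦ ?_⟩
    · conv_rhs => rw [← gl_apply_inv_apply_pt p.1 x, ← gl_apply_inv_apply_pt p.1 y, h₁]
      rw [Prod.fst_inv, ← mul_assoc, inv_mul_cancel₀ hν, one_mul]
    · conv_rhs => rw [← gl_apply_inv_apply_pt p.2 x, ← gl_apply_inv_apply_pt p.2 y, h₂]
      rw [Prod.snd_inv, ← mul_assoc, inv_mul_cancel₀ hν, one_mul]

variable {K} in
/-- Membership in the fibre product. [cite: Milne1999LefschetzClasses, §4 Definition 4.6 (p. 659)] -/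
theorem Polarization.mem_lefschetzSimilitudeGroupBaseChangeFibreProd_iff
    (p : ((K ⊗[ℚ] V₁) ≃ₗ[K] (K ⊗[ℚ] V₁)) × ((K ⊗[ℚ] V₂) ≃ₗ[K] (K ⊗[ℚ] V₂))) :
    p ∈ Q₁.lefschetzSimilitudeGroupBaseChangeFibreProd K Q₂ ↔
      (∀ a : H₁.endAlg, ∀ x, (a : Module.End ℚ V₁).baseChange K (p.1 x) = p.1 ((a : Module.End ℚ V₁).baseChange K x)) ∧
        (∀ b : H₂.endAlg, ∀ y, (b : Module.End ℚ V₂).baseChange K (p.2 y) = p.2 ((b : Module.End ℚ V₂).baseChange K y)) ∧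
          ∃ ν : K, ν ≠ 0 ∧ (∀ x y, Q₁.form.baseChange K (p.1 x) (p.1 y) = ν * Q₁.form.baseChange K x y) ∧
            ∀ x y, Q₂.form.baseChange K (p.2 x) (p.2 y) = ν * Q₂.form.baseChange K x y :=
  Iff.rfl

/-- "the largest subgroup of `∏ Gᵢ` on which the characters agree": the fibre product lies in `G(H₁)(K) × G(H₂)(K)`.
[cite: Milne1999LefschetzClasses, §4 Definition 4.6 (p. 659)] -/
theorem Polarization.lefschetzSimilitudeGroupBaseChangeFibreProd_le_prod :
    Q₁.lefschetzSimilitudeGroupBaseChangeFibreProd K Q₂ ≤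
      (Q₁.lefschetzSimilitudeGroupBaseChange K).prod (Q₂.lefschetzSimilitudeGroupBaseChange K) := by
  rintro p ⟨h₁, h₂, ν, hν, hm₁, hm₂⟩
  exact ⟨⟨h₁, ν, hν, hm₁⟩, ⟨h₂, ν, hν, hm₂⟩⟩

/-- The kernel of the common character: `S(H₁)(K) × S(H₂)(K)` lies in the fibre product (common multiplier `ν = 1`) — the
row `0 → ∏ S(Aᵢ) → L → 𝔾_m` of the proof of Corollary 4.7. [cite: Milne1999LefschetzClasses, §4 Corollary 4.7 (proof, p. 660)] -/
theorem Polarization.prod_lefschetzGroupBaseChange_le_lefschetzSimilitudeGroupBaseChangeFibreProd :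
    (Q₁.lefschetzGroupBaseChange K).prod (Q₂.lefschetzGroupBaseChange K) ≤
      Q₁.lefschetzSimilitudeGroupBaseChangeFibreProd K Q₂ := by
  rintro p ⟨h₁, h₂⟩
  exact ⟨h₁.1, h₂.1, 1, one_ne_zero, fun x y ↦ by rw [h₁.2, one_mul], fun x y ↦ by rw [h₂.2, one_mul]⟩

/-- A pair of the fibre product with common multiplier `1` is a pair of `S(H₁)(K) × S(H₂)(K)` (exactness at `L` of the rows in
the proof of Corollary 4.7, on points). [cite: Milne1999LefschetzClasses, §4 Corollary 4.7 (proof, p. 660) and p. 659 L28–L31] -/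
theorem Polarization.mem_prod_lefschetzGroupBaseChange_of_mul_one
    {p : ((K ⊗[ℚ] V₁) ≃ₗ[K] (K ⊗[ℚ] V₁)) × ((K ⊗[ℚ] V₂) ≃ₗ[K] (K ⊗[ℚ] V₂))}
    (hp : p ∈ Q₁.lefschetzSimilitudeGroupBaseChangeFibreProd K Q₂)
    (h₁ : ∀ x y, Q₁.form.baseChange K (p.1 x) (p.1 y) = Q₁.form.baseChange K x y)
    (h₂ : ∀ x y, Q₂.form.baseChange K (p.2 x) (p.2 y) = Q₂.form.baseChange K x y) :
    p ∈ (Q₁.lefschetzGroupBaseChange K).prod (Q₂.lefschetzGroupBaseChange K) :=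
  ⟨⟨hp.1, h₁⟩, ⟨hp.2.1, h₂⟩⟩

end FibreProd

/-! ## §2 `G(H₁ ⊕ H₂)(K) ⊆` the fibre product: block-diagonality and the blocks, with the multiplier of `γ` -/

section Restrict

variable {K Q₁ Q₂}

/-- An element of `G(H₁ ⊕ H₂)(K)` commutes with the base-changed Hodge idempotent `(in₁ pr₁)_K` (it commutes with
`E_φ(H₁ ⊕ H₂) ⊗ K`). [cite: Moonen2004MT, §4 Lemma 4.6] [cite: Milne1999LefschetzClasses, §4 Corollary 4.7 and §1 Prop. 1.1] -/
theorem Polarization.inl_fst_baseChange_apply_of_mem_lefschetzSimilitudeGroupBaseChange_prod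
    {γ : (K ⊗[ℚ] (V₁ × V₂)) ≃ₗ[K] (K ⊗[ℚ] (V₁ × V₂))} (hγ : γ ∈ (Q₁.prod Q₂).lefschetzSimilitudeGroupBaseChange K)
    (z : K ⊗[ℚ] (V₁ × V₂)) :
    (LinearMap.inl ℚ V₁ V₂).baseChange K ((LinearMap.fst ℚ V₁ V₂).baseChange K (γ z)) =
      γ ((LinearMap.inl ℚ V₁ V₂).baseChange K ((LinearMap.fst ℚ V₁ V₂).baseChange K z)) := by
  have h : (LinearMap.inl ℚ V₁ V₂ ∘ₗ LinearMap.fst ℚ V₁ V₂).baseChange K (γ z) =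
      γ ((LinearMap.inl ℚ V₁ V₂ ∘ₗ LinearMap.fst ℚ V₁ V₂).baseChange K z) :=
    hγ.1 ⟨LinearMap.inl ℚ V₁ V₂ ∘ₗ LinearMap.fst ℚ V₁ V₂,
      Hom.toLinearMap_mem_endAlg ((Hom.prodInl H₁ H₂).comp (Hom.prodFst H₁ H₂))⟩ z
  simpa only [LinearMap.baseChange_comp, LinearMap.coe_comp, Function.comp_apply] using h

/-- The same for `(in₂ pr₂)_K`. [cite: Moonen2004MT, §4 Lemma 4.6] [cite: Milne1999LefschetzClasses, §4 Corollary 4.7 and §1 Prop. 1.1] -/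
theorem Polarization.inr_snd_baseChange_apply_of_mem_lefschetzSimilitudeGroupBaseChange_prod
    {γ : (K ⊗[ℚ] (V₁ × V₂)) ≃ₗ[K] (K ⊗[ℚ] (V₁ × V₂))} (hγ : γ ∈ (Q₁.prod Q₂).lefschetzSimilitudeGroupBaseChange K)
    (z : K ⊗[ℚ] (V₁ × V₂)) :
    (LinearMap.inr ℚ V₁ V₂).baseChange K ((LinearMap.snd ℚ V₁ V₂).baseChange K (γ z)) =
      γ ((LinearMap.inr ℚ V₁ V₂).baseChange K ((LinearMap.snd ℚ V₁ V₂).baseChange K z)) := by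
  have h : (LinearMap.inr ℚ V₁ V₂ ∘ₗ LinearMap.snd ℚ V₁ V₂).baseChange K (γ z) =
      γ ((LinearMap.inr ℚ V₁ V₂ ∘ₗ LinearMap.snd ℚ V₁ V₂).baseChange K z) :=
    hγ.1 ⟨LinearMap.inr ℚ V₁ V₂ ∘ₗ LinearMap.snd ℚ V₁ V₂,
      Hom.toLinearMap_mem_endAlg ((Hom.prodInr H₁ H₂).comp (Hom.prodSnd H₁ H₂))⟩ z
  simpa only [LinearMap.baseChange_comp, LinearMap.coe_comp, Function.comp_apply] using h

/-- Block-diagonality, I: for `γ ∈ G(H₁ ⊕ H₂)(K)` the `(2,1)`-block vanishes, `pr₂ (γ (in₁ x)) = 0`.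
[cite: Milne1999LefschetzClasses, §1 Prop. 1.1 (p. 643) and §4 Corollary 4.7] [cite: Moonen2004MT, §4 Lemma 4.6] -/
theorem Polarization.snd_baseChange_apply_inl_baseChange_of_mem_lefschetzSimilitudeGroupBaseChange_prod
    {γ : (K ⊗[ℚ] (V₁ × V₂)) ≃ₗ[K] (K ⊗[ℚ] (V₁ × V₂))} (hγ : γ ∈ (Q₁.prod Q₂).lefschetzSimilitudeGroupBaseChange K)
    (x : K ⊗[ℚ] V₁) :
    (LinearMap.snd ℚ V₁ V₂).baseChange K (γ ((LinearMap.inl ℚ V₁ V₂).baseChange K x)) = 0 := by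
  have h := Polarization.inr_snd_baseChange_apply_of_mem_lefschetzSimilitudeGroupBaseChange_prod hγ
    ((LinearMap.inl ℚ V₁ V₂).baseChange K x)
  rw [snd_inl_pt, map_zero, map_zero] at h
  have h' := congrArg ((LinearMap.snd ℚ V₁ V₂).baseChange K) h
  rwa [snd_inr_pt, map_zero] at h'

/-- Block-diagonality, II: for `γ ∈ G(H₁ ⊕ H₂)(K)` the `(1,2)`-block vanishes, `pr₁ (γ (in₂ y)) = 0`.
[cite: Milne1999LefschetzClasses, §1 Prop. 1.1 (p. 643) and §4 Corollary 4.7] [cite: Moonen2004MT, §4 Lemma 4.6] -/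
theorem Polarization.fst_baseChange_apply_inr_baseChange_of_mem_lefschetzSimilitudeGroupBaseChange_prod
    {γ : (K ⊗[ℚ] (V₁ × V₂)) ≃ₗ[K] (K ⊗[ℚ] (V₁ × V₂))} (hγ : γ ∈ (Q₁.prod Q₂).lefschetzSimilitudeGroupBaseChange K)
    (y : K ⊗[ℚ] V₂) :
    (LinearMap.fst ℚ V₁ V₂).baseChange K (γ ((LinearMap.inr ℚ V₁ V₂).baseChange K y)) = 0 := by
  have h := Polarization.inl_fst_baseChange_apply_of_mem_lefschetzSimilitudeGroupBaseChange_prod hγ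
    ((LinearMap.inr ℚ V₁ V₂).baseChange K y)
  rw [fst_inr_pt, map_zero, map_zero] at h
  have h' := congrArg ((LinearMap.fst ℚ V₁ V₂).baseChange K) h
  rwa [fst_inl_pt, map_zero] at h'

/-- **The blocks `(pr₁ γ in₁, pr₂ γ in₂)` of `γ ∈ G(H₁ ⊕ H₂)(K)` form a pair of the fibre product, with the multiplier of `γ`
as the common multiplier**: each block commutes with `E_φ(Hᵢ) ⊗ K` (as `γ` commutes with `(in₁ a pr₁)_K`, `(in₂ b pr₂)_K`), and
`Q₁,K(pr₁ γ in₁ x, pr₁ γ in₁ y) = (Q₁ ⊕ Q₂)_K(γ in₁ x, γ in₁ y) = ν (Q₁ ⊕ Q₂)_K(in₁ x, in₁ y) = ν Q₁,K(x, y)` (the off-diagonal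
blocks vanish), likewise for `Q₂` — the map `L(A) → ∏ (L(Aᵢ), l(Aᵢ))` of Corollary 4.7 on points.
[cite: Milne1999LefschetzClasses, §4 Definition 4.6 and Corollary 4.7 (pp. 659–660)] [cite: Moonen2004MT, §4 Lemma 4.6] -/
theorem Polarization.restrictRetract_pair_mem_lefschetzSimilitudeGroupBaseChangeFibreProd
    {γ : (K ⊗[ℚ] (V₁ × V₂)) ≃ₗ[K] (K ⊗[ℚ] (V₁ × V₂))} (hγ : γ ∈ (Q₁.prod Q₂).lefschetzSimilitudeGroupBaseChange K) :
    (restrictRetract ((LinearMap.inl ℚ V₁ V₂).baseChange K) ((LinearMap.fst ℚ V₁ V₂).baseChange K)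
          (baseChange_retract_apply K (ι := LinearMap.inl ℚ V₁ V₂) (π := LinearMap.fst ℚ V₁ V₂) fun _ ↦ rfl) γ
          (Polarization.inl_fst_baseChange_apply_of_mem_lefschetzSimilitudeGroupBaseChange_prod hγ),
        restrictRetract ((LinearMap.inr ℚ V₁ V₂).baseChange K) ((LinearMap.snd ℚ V₁ V₂).baseChange K)
          (baseChange_retract_apply K (ι := LinearMap.inr ℚ V₁ V₂) (π := LinearMap.snd ℚ V₁ V₂) fun _ ↦ rfl) γ
          (Polarization.inr_snd_baseChange_apply_of_mem_lefschetzSimilitudeGroupBaseChange_prod hγ)) ∈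
      Q₁.lefschetzSimilitudeGroupBaseChangeFibreProd K Q₂ := by
  obtain ⟨ν, hν, hm⟩ := hγ.2
  refine ⟨fun a x ↦ ?_, fun b y ↦ ?_, ν, hν, fun x y ↦ ?_, fun x y ↦ ?_⟩
  · -- commutation of the first block with `a_K`, `a ∈ E_φ(H₁)`
    simp only [restrictRetract_apply]
    have hA : (LinearMap.inl ℚ V₁ V₂ ∘ₗ (a : Module.End ℚ V₁) ∘ₗ LinearMap.fst ℚ V₁ V₂).baseChange K
          (γ ((LinearMap.inl ℚ V₁ V₂).baseChange K x)) =
        γ ((LinearMap.inl ℚ V₁ V₂ ∘ₗ (a : Module.End ℚ V₁) ∘ₗ LinearMap.fst ℚ V₁ V₂).baseChange K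
          ((LinearMap.inl ℚ V₁ V₂).baseChange K x)) :=
      hγ.1 ⟨_, inl_comp_comp_fst_mem_endAlg_prod H₁ H₂ a.2⟩ ((LinearMap.inl ℚ V₁ V₂).baseChange K x)
    simp only [LinearMap.baseChange_comp, LinearMap.coe_comp, Function.comp_apply, fst_inl_pt] at hA
    rw [← hA, fst_inl_pt]
  · -- commutation of the second block with `b_K`, `b ∈ E_φ(H₂)`
    simp only [restrictRetract_apply]
    have hB : (LinearMap.inr ℚ V₁ V₂ ∘ₗ (b : Module.End ℚ V₂) ∘ₗ LinearMap.snd ℚ V₁ V₂).baseChange K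
          (γ ((LinearMap.inr ℚ V₁ V₂).baseChange K y)) =
        γ ((LinearMap.inr ℚ V₁ V₂ ∘ₗ (b : Module.End ℚ V₂) ∘ₗ LinearMap.snd ℚ V₁ V₂).baseChange K
          ((LinearMap.inr ℚ V₁ V₂).baseChange K y)) :=
      hγ.1 ⟨_, inr_comp_comp_snd_mem_endAlg_prod H₁ H₂ b.2⟩ ((LinearMap.inr ℚ V₁ V₂).baseChange K y)
    simp only [LinearMap.baseChange_comp, LinearMap.coe_comp, Function.comp_apply, snd_inr_pt] at hB
    rw [← hB, snd_inr_pt]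
  · -- the multiplier of the first block is `ν`
    simp only [restrictRetract_apply]
    have key := hm ((LinearMap.inl ℚ V₁ V₂).baseChange K x) ((LinearMap.inl ℚ V₁ V₂).baseChange K y)
    simpa only [Polarization.baseChange_prod_form_apply,
      Polarization.snd_baseChange_apply_inl_baseChange_of_mem_lefschetzSimilitudeGroupBaseChange_prod hγ, fst_inl_pt,
      snd_inl_pt, map_zero, LinearMap.zero_apply, add_zero] using key
  · -- the multiplier of the second block is `ν`
    simp only [restrictRetract_apply]
    have key := hm ((LinearMap.inr ℚ V₁ V₂).baseChange K x) ((LinearMap.inr ℚ V₁ V₂).baseChange K y)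
    simpa only [Polarization.baseChange_prod_form_apply,
      Polarization.fst_baseChange_apply_inr_baseChange_of_mem_lefschetzSimilitudeGroupBaseChange_prod hγ, snd_inr_pt,
      fst_inr_pt, map_zero, LinearMap.zero_apply, zero_add] using key

/-- **`γ ∈ G(H₁ ⊕ H₂)(K)` is block diagonal**: `γ = (pr₁ γ in₁) ⊕ (pr₂ γ in₂)`.
[cite: Milne1999LefschetzClasses, §1 Prop. 1.1 (p. 643) and §4 Corollary 4.7] [cite: Moonen2004MT, §4 Lemma 4.6] -/
theorem Polarization.eq_blockDiag_of_mem_lefschetzSimilitudeGroupBaseChange_prod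
    {γ : (K ⊗[ℚ] (V₁ × V₂)) ≃ₗ[K] (K ⊗[ℚ] (V₁ × V₂))} (hγ : γ ∈ (Q₁.prod Q₂).lefschetzSimilitudeGroupBaseChange K) :
    γ = blockDiag K V₁ V₂
      (restrictRetract ((LinearMap.inl ℚ V₁ V₂).baseChange K) ((LinearMap.fst ℚ V₁ V₂).baseChange K)
          (baseChange_retract_apply K (ι := LinearMap.inl ℚ V₁ V₂) (π := LinearMap.fst ℚ V₁ V₂) fun _ ↦ rfl) γ
          (Polarization.inl_fst_baseChange_apply_of_mem_lefschetzSimilitudeGroupBaseChange_prod hγ),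
        restrictRetract ((LinearMap.inr ℚ V₁ V₂).baseChange K) ((LinearMap.snd ℚ V₁ V₂).baseChange K)
          (baseChange_retract_apply K (ι := LinearMap.inr ℚ V₁ V₂) (π := LinearMap.snd ℚ V₁ V₂) fun _ ↦ rfl) γ
          (Polarization.inr_snd_baseChange_apply_of_mem_lefschetzSimilitudeGroupBaseChange_prod hγ)) := by
  refine LinearEquiv.ext fun z ↦ ?_
  rw [← LinearEquiv.coe_coe (blockDiag K V₁ V₂ _), coe_blockDiag]
  simp only [LinearMap.add_apply, LinearMap.coe_comp, Function.comp_apply, LinearEquiv.coe_coe, restrictRetract_apply]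
  rw [Polarization.inl_fst_baseChange_apply_of_mem_lefschetzSimilitudeGroupBaseChange_prod hγ, fst_inl_pt,
    Polarization.inr_snd_baseChange_apply_of_mem_lefschetzSimilitudeGroupBaseChange_prod hγ, snd_inr_pt, ← map_add,
    inl_fst_add_inr_snd_pt]

/-- **`G(H₁ ⊕ H₂)(K) ⊆ (G(H₁), l₁) ×_{K^×} (G(H₂), l₂)` through the block-diagonal embedding**, for every field `K ⊇ ℚ` (the
injective half of Corollary 4.7 on points, valid without any hypothesis on `Hom(H₁, H₂)`).
[cite: Milne1999LefschetzClasses, §4 Corollary 4.7 (pp. 659–660) and §1 Prop. 1.1] -/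
theorem Polarization.lefschetzSimilitudeGroupBaseChange_prod_le_map_blockDiag (K : Type uK) [Field K] [Algebra ℚ K]
    (Q₁ : Polarization H₁) (Q₂ : Polarization H₂) :
    (Q₁.prod Q₂).lefschetzSimilitudeGroupBaseChange K ≤
      (Q₁.lefschetzSimilitudeGroupBaseChangeFibreProd K Q₂).map (blockDiag K V₁ V₂) := fun _ hγ ↦
  ⟨(_, _), Polarization.restrictRetract_pair_mem_lefschetzSimilitudeGroupBaseChangeFibreProd hγ,
    (Polarization.eq_blockDiag_of_mem_lefschetzSimilitudeGroupBaseChange_prod hγ).symm⟩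

end Restrict

/-! ## §3 Block-diagonal elements of `G(H₁ ⊕ H₂)(K)`: the common character and the intertwining relations -/

section Blocks

variable {K}

/-- **"the common restriction of these characters"**: for `γ₁ ⊕ γ₂` and `ν ∈ K`, the multiplier clause
`(Q₁ ⊕ Q₂)_K(γ z, γ z') = ν (Q₁ ⊕ Q₂)_K(z, z')` holds iff BOTH `Q₁,K(γ₁ x, γ₁ y) = ν Q₁,K(x, y)` and
`Q₂,K(γ₂ x, γ₂ y) = ν Q₂,K(x, y)` (the product form is the orthogonal sum, g18-#5's `baseChange_prod_form_apply`).
[cite: Milne1999LefschetzClasses, §4 Definition 4.6 and Corollary 4.7 (pp. 659–660)] [cite: DeligneHodgeII1971, 2.1.15] -/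
theorem Polarization.forall_baseChange_prod_form_blockDiag_iff
    (γ₁ : (K ⊗[ℚ] V₁) ≃ₗ[K] (K ⊗[ℚ] V₁)) (γ₂ : (K ⊗[ℚ] V₂) ≃ₗ[K] (K ⊗[ℚ] V₂)) (ν : K) :
    (∀ z z', (Q₁.prod Q₂).form.baseChange K (blockDiag K V₁ V₂ (γ₁, γ₂) z) (blockDiag K V₁ V₂ (γ₁, γ₂) z') =
        ν * (Q₁.prod Q₂).form.baseChange K z z') ↔
      (∀ x y, Q₁.form.baseChange K (γ₁ x) (γ₁ y) = ν * Q₁.form.baseChange K x y) ∧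
        ∀ x y, Q₂.form.baseChange K (γ₂ x) (γ₂ y) = ν * Q₂.form.baseChange K x y := by
  constructor
  · intro h
    refine ⟨fun x y ↦ ?_, fun x y ↦ ?_⟩
    · have key := h ((LinearMap.inl ℚ V₁ V₂).baseChange K x) ((LinearMap.inl ℚ V₁ V₂).baseChange K y)
      simpa only [Polarization.baseChange_prod_form_apply, blockDiag_apply_inl_baseChange, fst_inl_pt, snd_inl_pt, map_zero,
        LinearMap.zero_apply, add_zero] using key
    · have key := h ((LinearMap.inr ℚ V₁ V₂).baseChange K x) ((LinearMap.inr ℚ V₁ V₂).baseChange K y)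
      simpa only [Polarization.baseChange_prod_form_apply, blockDiag_apply_inr_baseChange, fst_inr_pt, snd_inr_pt, map_zero,
        LinearMap.zero_apply, zero_add] using key
  · rintro ⟨h₁, h₂⟩ z z'
    rw [Polarization.baseChange_prod_form_apply, Polarization.baseChange_prod_form_apply, fst_baseChange_blockDiag_apply,
      fst_baseChange_blockDiag_apply, snd_baseChange_blockDiag_apply, snd_baseChange_blockDiag_apply, h₁, h₂, mul_add]

/-- **`γ₁ ⊕ γ₂ ∈ G(H₁ ⊕ H₂)(K)`, exactly**: iff `(γ₁, γ₂)` is a pair of the fibre product (common multiplier) and intertwines the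
base change of every morphism between the summands (`f_K γ₁ = γ₂ f_K` for `f : H₁ → H₂`, `g_K γ₂ = γ₁ g_K` for `g : H₂ → H₁`;
Prop. 1.1's relations). "⟹": §2 and the commutation with `(in₂ f pr₁)_K`, `(in₁ g pr₂)_K ∈ E_φ(H₁ ⊕ H₂) ⊗ K`; "⟸": every
`a ∈ E_φ(H₁ ⊕ H₂)` is the sum of its four blocks (g18-#3), and the multiplier clause is §3's common character.
[cite: Milne1999LefschetzClasses, §4 Corollary 4.7 (pp. 659–660), §1 Prop. 1.1 (p. 643)] -/
theorem Polarization.blockDiag_mem_lefschetzSimilitudeGroupBaseChange_prod_iff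
    (γ₁ : (K ⊗[ℚ] V₁) ≃ₗ[K] (K ⊗[ℚ] V₁)) (γ₂ : (K ⊗[ℚ] V₂) ≃ₗ[K] (K ⊗[ℚ] V₂)) :
    blockDiag K V₁ V₂ (γ₁, γ₂) ∈ (Q₁.prod Q₂).lefschetzSimilitudeGroupBaseChange K ↔
      (γ₁, γ₂) ∈ Q₁.lefschetzSimilitudeGroupBaseChangeFibreProd K Q₂ ∧
        (∀ f : Hom H₁ H₂, ∀ x, f.toLinearMap.baseChange K (γ₁ x) = γ₂ (f.toLinearMap.baseChange K x)) ∧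
          ∀ g : Hom H₂ H₁, ∀ y, g.toLinearMap.baseChange K (γ₂ y) = γ₁ (g.toLinearMap.baseChange K y) := by
  constructor
  · intro hγ
    -- the blocks of `γ₁ ⊕ γ₂` are `γ₁`, `γ₂`
    have e₁ : restrictRetract ((LinearMap.inl ℚ V₁ V₂).baseChange K) ((LinearMap.fst ℚ V₁ V₂).baseChange K)
        (baseChange_retract_apply K (ι := LinearMap.inl ℚ V₁ V₂) (π := LinearMap.fst ℚ V₁ V₂) fun _ ↦ rfl)
        (blockDiag K V₁ V₂ (γ₁, γ₂))
        (Polarization.inl_fst_baseChange_apply_of_mem_lefschetzSimilitudeGroupBaseChange_prod hγ) = γ₁ := by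
      refine LinearEquiv.ext fun x ↦ ?_
      rw [restrictRetract_apply, blockDiag_apply_inl_baseChange, fst_inl_pt]
    have e₂ : restrictRetract ((LinearMap.inr ℚ V₁ V₂).baseChange K) ((LinearMap.snd ℚ V₁ V₂).baseChange K)
        (baseChange_retract_apply K (ι := LinearMap.inr ℚ V₁ V₂) (π := LinearMap.snd ℚ V₁ V₂) fun _ ↦ rfl)
        (blockDiag K V₁ V₂ (γ₁, γ₂))
        (Polarization.inr_snd_baseChange_apply_of_mem_lefschetzSimilitudeGroupBaseChange_prod hγ) = γ₂ := by
      refine LinearEquiv.ext fun y ↦ ?_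
      rw [restrictRetract_apply, blockDiag_apply_inr_baseChange, snd_inr_pt]
    have hp := Polarization.restrictRetract_pair_mem_lefschetzSimilitudeGroupBaseChangeFibreProd hγ
    rw [e₁, e₂] at hp
    refine ⟨hp, fun f x ↦ ?_, fun g y ↦ ?_⟩
    · -- `γ₁ ⊕ γ₂` commutes with `(in₂ f pr₁)_K`; evaluate at `in₁ x` and project with `pr₂`
      have h : (LinearMap.inr ℚ V₁ V₂ ∘ₗ f.toLinearMap ∘ₗ LinearMap.fst ℚ V₁ V₂).baseChange K
            (blockDiag K V₁ V₂ (γ₁, γ₂) ((LinearMap.inl ℚ V₁ V₂).baseChange K x)) =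
          blockDiag K V₁ V₂ (γ₁, γ₂) ((LinearMap.inr ℚ V₁ V₂ ∘ₗ f.toLinearMap ∘ₗ LinearMap.fst ℚ V₁ V₂).baseChange K
            ((LinearMap.inl ℚ V₁ V₂).baseChange K x)) :=
        hγ.1 ⟨_, inr_comp_hom_comp_fst_mem_endAlg_prod H₁ H₂ f⟩ ((LinearMap.inl ℚ V₁ V₂).baseChange K x)
      simp only [LinearMap.baseChange_comp, LinearMap.coe_comp, Function.comp_apply, blockDiag_apply_inl_baseChange,
        blockDiag_apply_inr_baseChange, fst_inl_pt] at h
      have h' := congrArg ((LinearMap.snd ℚ V₁ V₂).baseChange K) h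
      rwa [snd_inr_pt, snd_inr_pt] at h'
    · have h : (LinearMap.inl ℚ V₁ V₂ ∘ₗ g.toLinearMap ∘ₗ LinearMap.snd ℚ V₁ V₂).baseChange K
            (blockDiag K V₁ V₂ (γ₁, γ₂) ((LinearMap.inr ℚ V₁ V₂).baseChange K y)) =
          blockDiag K V₁ V₂ (γ₁, γ₂) ((LinearMap.inl ℚ V₁ V₂ ∘ₗ g.toLinearMap ∘ₗ LinearMap.snd ℚ V₁ V₂).baseChange K
            ((LinearMap.inr ℚ V₁ V₂).baseChange K y)) :=
        hγ.1 ⟨_, inl_comp_hom_comp_snd_mem_endAlg_prod H₁ H₂ g⟩ ((LinearMap.inr ℚ V₁ V₂).baseChange K y)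
      simp only [LinearMap.baseChange_comp, LinearMap.coe_comp, Function.comp_apply, blockDiag_apply_inl_baseChange,
        blockDiag_apply_inr_baseChange, snd_inr_pt] at h
      have h' := congrArg ((LinearMap.fst ℚ V₁ V₂).baseChange K) h
      rwa [fst_inl_pt, fst_inl_pt] at h'
  · rintro ⟨⟨h₁, h₂, ν, hν, hm₁, hm₂⟩, hf, hg⟩
    refine ⟨fun a z ↦ ?_, ν, hν, (Q₁.forall_baseChange_prod_form_blockDiag_iff Q₂ γ₁ γ₂ ν).2 ⟨hm₁, hm₂⟩⟩
    -- commutation with `a_K`: decompose `a ∈ E_φ(H₁ ⊕ H₂)` into its four blocks and `z` along the two idempotents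
    obtain ⟨f, hf'⟩ := exists_hom_toLinearMap_eq_snd_comp_comp_inl H₁ H₂ a.2
    obtain ⟨g, hg'⟩ := exists_hom_toLinearMap_eq_fst_comp_comp_inr H₁ H₂ a.2
    have ha₁₁ : ∀ x, (LinearMap.fst ℚ V₁ V₂ ∘ₗ (a : Module.End ℚ (V₁ × V₂)) ∘ₗ LinearMap.inl ℚ V₁ V₂).baseChange K (γ₁ x) =
        γ₁ ((LinearMap.fst ℚ V₁ V₂ ∘ₗ (a : Module.End ℚ (V₁ × V₂)) ∘ₗ LinearMap.inl ℚ V₁ V₂).baseChange K x) :=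
      h₁ ⟨_, fst_comp_comp_inl_mem_endAlg H₁ H₂ a.2⟩
    have ha₂₂ : ∀ y, (LinearMap.snd ℚ V₁ V₂ ∘ₗ (a : Module.End ℚ (V₁ × V₂)) ∘ₗ LinearMap.inr ℚ V₁ V₂).baseChange K (γ₂ y) =
        γ₂ ((LinearMap.snd ℚ V₁ V₂ ∘ₗ (a : Module.End ℚ (V₁ × V₂)) ∘ₗ LinearMap.inr ℚ V₁ V₂).baseChange K y) :=
      h₂ ⟨_, snd_comp_comp_inr_mem_endAlg H₁ H₂ a.2⟩
    have ha₂₁ : ∀ x, (LinearMap.snd ℚ V₁ V₂ ∘ₗ (a : Module.End ℚ (V₁ × V₂)) ∘ₗ LinearMap.inl ℚ V₁ V₂).baseChange K (γ₁ x) =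
        γ₂ ((LinearMap.snd ℚ V₁ V₂ ∘ₗ (a : Module.End ℚ (V₁ × V₂)) ∘ₗ LinearMap.inl ℚ V₁ V₂).baseChange K x) := by
      rw [← hf']
      exact hf f
    have ha₁₂ : ∀ y, (LinearMap.fst ℚ V₁ V₂ ∘ₗ (a : Module.End ℚ (V₁ × V₂)) ∘ₗ LinearMap.inr ℚ V₁ V₂).baseChange K (γ₂ y) =
        γ₁ ((LinearMap.fst ℚ V₁ V₂ ∘ₗ (a : Module.End ℚ (V₁ × V₂)) ∘ₗ LinearMap.inr ℚ V₁ V₂).baseChange K y) := by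
      rw [← hg']
      exact hg g
    rw [← inl_fst_add_inr_snd_pt K z]
    simp only [map_add, blockDiag_apply_inl_baseChange, blockDiag_apply_inr_baseChange,
      baseChange_apply_inl_pt K (a : Module.End ℚ (V₁ × V₂)), baseChange_apply_inr_pt K (a : Module.End ℚ (V₁ × V₂)),
      ha₁₁, ha₂₂, ha₂₁, ha₁₂]

end Blocks

/-! ## §4 Corollary 4.7 on `K`-points: `(G(H₁), l₁) ×_{K^×} (G(H₂), l₂) ≅ G(H₁ ⊕ H₂)(K)` iff `Hom(H₁, H₂) = 0 = Hom(H₂, H₁)` -/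

section CorFourSeven

/-- In a `ℚ`-vector space `-x = x` forces `x = 0`. Private plumbing. [folklore] -/
private theorem eq_zero_of_neg_eq_self_pt {W : Type*} [AddCommGroup W] [Module ℚ W] {x : W} (h : -x = x) : x = 0 := by
  have h2 : (2 : ℚ) • x = 0 := by
    rw [two_smul]
    nth_rw 1 [← h]
    exact neg_add_cancel x
  exact (smul_eq_zero.1 h2).resolve_left (by norm_num)

/-- **Corollary 4.7 on `K`-points, `s = 2`: `blockDiag` maps the WHOLE fibre product into `G(H₁ ⊕ H₂)(K)` exactly when there are
no morphisms between the summands** (Milne: `Aᵢ` simple and pairwise nonisogenous) — "⟹" tests the pair `(1, -1)` (common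
multiplier `1`), which intertwines `f_K` only if `-f_K = f_K`, and `f_K = 0 ⟹ f = 0` (g18-#5's
`Hom.toLinearMap_eq_zero_of_baseChange_eq_zero`). [cite: Milne1999LefschetzClasses, §4 Corollary 4.7 (pp. 659–660) and §1 Prop. 1.1, Prop. 1.5] -/
theorem Polarization.forall_blockDiag_mem_lefschetzSimilitudeGroupBaseChange_prod_iff :
    (∀ p ∈ Q₁.lefschetzSimilitudeGroupBaseChangeFibreProd K Q₂,
        blockDiag K V₁ V₂ p ∈ (Q₁.prod Q₂).lefschetzSimilitudeGroupBaseChange K) ↔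
      (∀ f : Hom H₁ H₂, f.toLinearMap = 0) ∧ ∀ g : Hom H₂ H₁, g.toLinearMap = 0 := by
  constructor
  · intro h
    have hp : ((1 : (K ⊗[ℚ] V₁) ≃ₗ[K] (K ⊗[ℚ] V₁)), LinearEquiv.neg K) ∈ Q₁.lefschetzSimilitudeGroupBaseChangeFibreProd K Q₂ :=
      Q₁.prod_lefschetzGroupBaseChange_le_lefschetzSimilitudeGroupBaseChangeFibreProd K Q₂
        ⟨Subgroup.one_mem _, Q₂.neg_mem_lefschetzGroupBaseChange K⟩
    have h1 := (Q₁.blockDiag_mem_lefschetzSimilitudeGroupBaseChange_prod_iff Q₂ 1 (LinearEquiv.neg K)).1 (h _ hp)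
    refine ⟨fun f ↦ Hom.toLinearMap_eq_zero_of_baseChange_eq_zero K fun x ↦ ?_,
      fun g ↦ Hom.toLinearMap_eq_zero_of_baseChange_eq_zero K fun y ↦ ?_⟩
    · have hf := h1.2.1 f x
      rw [LinearEquiv.coe_one, id_eq, LinearEquiv.neg_apply] at hf
      exact eq_zero_of_neg_eq_self_pt hf.symm
    · have hg := h1.2.2 g y
      rw [LinearEquiv.coe_one, id_eq, LinearEquiv.neg_apply, map_neg] at hg
      exact eq_zero_of_neg_eq_self_pt hg
  · rintro ⟨hf, hg⟩ ⟨γ₁, γ₂⟩ hp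
    exact (Q₁.blockDiag_mem_lefschetzSimilitudeGroupBaseChange_prod_iff Q₂ γ₁ γ₂).2
      ⟨hp, fun f x ↦ by rw [hf f, LinearMap.baseChange_zero, LinearMap.zero_apply, LinearMap.zero_apply, map_zero],
        fun g y ↦ by rw [hg g, LinearMap.baseChange_zero, LinearMap.zero_apply, LinearMap.zero_apply, map_zero]⟩

/-- **Corollary 4.7 on `K`-points (`s = 2`): `G(H₁ ⊕ H₂)(K) = ((G(H₁), l₁) ×_{K^×} (G(H₂), l₂))(K)`, block-diagonally embedded, when
`Hom(H₁, H₂) = 0 = Hom(H₂, H₁)`**, for every field `K ⊇ ℚ`. [cite: Milne1999LefschetzClasses, §4 Corollary 4.7 (pp. 659–660) and Remark 1.6] -/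
theorem Polarization.lefschetzSimilitudeGroupBaseChange_prod_eq_map_blockDiag_of_hom_eq_zero
    (hf : ∀ f : Hom H₁ H₂, f.toLinearMap = 0) (hg : ∀ g : Hom H₂ H₁, g.toLinearMap = 0) :
    (Q₁.prod Q₂).lefschetzSimilitudeGroupBaseChange K =
      (Q₁.lefschetzSimilitudeGroupBaseChangeFibreProd K Q₂).map (blockDiag K V₁ V₂) := by
  refine le_antisymm (Q₁.lefschetzSimilitudeGroupBaseChange_prod_le_map_blockDiag K Q₂) ?_
  rintro _ ⟨p, hp, rfl⟩
  exact (Q₁.forall_blockDiag_mem_lefschetzSimilitudeGroupBaseChange_prod_iff K Q₂).2 ⟨hf, hg⟩ p hp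

/-- Membership form: when the summands have no morphisms between them, `γ ∈ G(H₁ ⊕ H₂)(K)` iff `γ = γ₁ ⊕ γ₂` for a pair
`(γ₁, γ₂)` of the fibre product. [cite: Milne1999LefschetzClasses, §4 Corollary 4.7 (pp. 659–660) and Remark 1.6] -/
theorem Polarization.mem_lefschetzSimilitudeGroupBaseChange_prod_iff_of_hom_eq_zero
    (hf : ∀ f : Hom H₁ H₂, f.toLinearMap = 0) (hg : ∀ g : Hom H₂ H₁, g.toLinearMap = 0)
    (γ : (K ⊗[ℚ] (V₁ × V₂)) ≃ₗ[K] (K ⊗[ℚ] (V₁ × V₂))) :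
    γ ∈ (Q₁.prod Q₂).lefschetzSimilitudeGroupBaseChange K ↔
      ∃ p ∈ Q₁.lefschetzSimilitudeGroupBaseChangeFibreProd K Q₂, γ = blockDiag K V₁ V₂ p := by
  rw [Q₁.lefschetzSimilitudeGroupBaseChange_prod_eq_map_blockDiag_of_hom_eq_zero K Q₂ hf hg, Subgroup.mem_map]
  constructor
  · rintro ⟨p, hp, rfl⟩
    exact ⟨p, hp, rfl⟩
  · rintro ⟨p, hp, rfl⟩
    exact ⟨p, hp, rfl⟩

/-- **The isomorphism of Corollary 4.7 on `K`-points** (`s = 2`): when `Hom(H₁, H₂) = 0 = Hom(H₂, H₁)`, `(γ₁, γ₂) ↦ γ₁ ⊕ γ₂` is a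
group isomorphism `((G(H₁), l₁) ×_{K^×} (G(H₂), l₂))(K) ≃* G(H₁ ⊕ H₂)(K)` (`blockDiag` is injective, the tree's
`blockDiag_injective`; Mathlib's `Subgroup.equivMapOfInjective`). [cite: Milne1999LefschetzClasses, §4 Corollary 4.7 (pp. 659–660) and Remark 1.6] -/
def Polarization.lefschetzSimilitudeGroupBaseChangeFibreProdMulEquiv
    (hf : ∀ f : Hom H₁ H₂, f.toLinearMap = 0) (hg : ∀ g : Hom H₂ H₁, g.toLinearMap = 0) :
    Q₁.lefschetzSimilitudeGroupBaseChangeFibreProd K Q₂ ≃* (Q₁.prod Q₂).lefschetzSimilitudeGroupBaseChange K :=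
  ((Q₁.lefschetzSimilitudeGroupBaseChangeFibreProd K Q₂).equivMapOfInjective (blockDiag K V₁ V₂)
      blockDiag_injective).trans
    (MulEquiv.subgroupCongr (Q₁.lefschetzSimilitudeGroupBaseChange_prod_eq_map_blockDiag_of_hom_eq_zero K Q₂ hf hg).symm)

/-- The isomorphism is `(γ₁, γ₂) ↦ γ₁ ⊕ γ₂`. [cite: Milne1999LefschetzClasses, §4 Corollary 4.7 (pp. 659–660)] -/
theorem Polarization.coe_lefschetzSimilitudeGroupBaseChangeFibreProdMulEquiv_apply
    (hf : ∀ f : Hom H₁ H₂, f.toLinearMap = 0) (hg : ∀ g : Hom H₂ H₁, g.toLinearMap = 0)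
    (p : Q₁.lefschetzSimilitudeGroupBaseChangeFibreProd K Q₂) :
    ((Q₁.lefschetzSimilitudeGroupBaseChangeFibreProdMulEquiv K Q₂ hf hg p :
        (Q₁.prod Q₂).lefschetzSimilitudeGroupBaseChange K) : (K ⊗[ℚ] (V₁ × V₂)) ≃ₗ[K] (K ⊗[ℚ] (V₁ × V₂))) =
      blockDiag K V₁ V₂ (p : ((K ⊗[ℚ] V₁) ≃ₗ[K] (K ⊗[ℚ] V₁)) × ((K ⊗[ℚ] V₂) ≃ₗ[K] (K ⊗[ℚ] V₂))) :=
  rfl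

end CorFourSeven

/-! ## §5 Powers: "`L(A^r) = L(A)`" on `K`-points (`r = 2`, the diagonal) -/

section Powers

variable {K} {V : Type u} [AddCommGroup V] [Module ℚ V] {H : HodgeStructure V n} (Q : Polarization H)

/-- **`γ₁ ⊕ γ₂ ∈ G(H ⊕ H)(K) ⟺ γ₁ = γ₂ ∈ G(H)(K)`** (intertwining with `id ∈ Hom(H, H)` forces `γ₁ = γ₂`; conversely
`γ ∈ G(H)(K)` intertwines every `f ∈ Hom(H, H) = E_φ`, and `(γ, γ)` is a pair of the fibre product with the multiplier of `γ`).
[cite: Milne1999LefschetzClasses, §4 Corollary 4.7 (isogeny `A → A₁^{r₁} × ⋯`, pp. 659–660) and §3 p. 654 ("S(A) = S(A^r)")] -/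
theorem Polarization.blockDiag_mem_lefschetzSimilitudeGroupBaseChange_prod_self_iff
    (γ₁ γ₂ : (K ⊗[ℚ] V) ≃ₗ[K] (K ⊗[ℚ] V)) :
    blockDiag K V V (γ₁, γ₂) ∈ (Q.prod Q).lefschetzSimilitudeGroupBaseChange K ↔
      γ₁ ∈ Q.lefschetzSimilitudeGroupBaseChange K ∧ γ₂ = γ₁ := by
  rw [Q.blockDiag_mem_lefschetzSimilitudeGroupBaseChange_prod_iff Q]
  constructor
  · rintro ⟨hp, hf, -⟩
    refine ⟨(Q.lefschetzSimilitudeGroupBaseChangeFibreProd_le_prod K Q hp).1, LinearEquiv.ext fun x ↦ ?_⟩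
    have h := hf (Hom.id H) x
    change (LinearMap.id : V →ₗ[ℚ] V).baseChange K (γ₁ x) = γ₂ ((LinearMap.id : V →ₗ[ℚ] V).baseChange K x) at h
    rw [LinearMap.baseChange_id, LinearMap.id_apply, LinearMap.id_apply] at h
    exact h.symm
  · rintro ⟨h₁, rfl⟩
    obtain ⟨ν, hν, hm⟩ := h₁.2
    exact ⟨⟨h₁.1, h₁.1, ν, hν, hm, hm⟩, fun f x ↦ h₁.1 ⟨f.toLinearMap, Hom.toLinearMap_mem_endAlg f⟩ x,
      fun g y ↦ h₁.1 ⟨g.toLinearMap, Hom.toLinearMap_mem_endAlg g⟩ y⟩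

/-- **"`L(A^r) = L(A)`" on `K`-points** (`r = 2`): `G(H ⊕ H)(K) = Δ G(H)(K)`, the image of `G(H)(K)` under the diagonal
embedding `γ ↦ γ ⊕ γ` (the tree's `diagEmbedding`). [cite: Milne1999LefschetzClasses, §4 Corollary 4.7 (pp. 659–660) and §3 p. 654] -/
theorem Polarization.lefschetzSimilitudeGroupBaseChange_prod_self_eq_map_diagEmbedding (K : Type uK) [Field K] [Algebra ℚ K] :
    (Q.prod Q).lefschetzSimilitudeGroupBaseChange K = (Q.lefschetzSimilitudeGroupBaseChange K).map (diagEmbedding K V) := by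
  refine le_antisymm (fun γ hγ ↦ ?_) ?_
  · obtain ⟨⟨γ₁, γ₂⟩, -, hγ'⟩ := Q.lefschetzSimilitudeGroupBaseChange_prod_le_map_blockDiag K Q hγ
    rw [← hγ'] at hγ
    obtain ⟨h₁, h₂⟩ := (Q.blockDiag_mem_lefschetzSimilitudeGroupBaseChange_prod_self_iff γ₁ γ₂).1 hγ
    refine ⟨γ₁, h₁, ?_⟩
    rw [diagEmbedding_apply, ← hγ', h₂]
  · rintro _ ⟨γ₀, h₀, rfl⟩
    rw [diagEmbedding_apply]
    exact (Q.blockDiag_mem_lefschetzSimilitudeGroupBaseChange_prod_self_iff γ₀ γ₀).2 ⟨h₀, rfl⟩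

/-- Membership form: `γ ∈ G(H ⊕ H)(K)` iff `γ = γ₀ ⊕ γ₀` for some `γ₀ ∈ G(H)(K)`.
[cite: Milne1999LefschetzClasses, §4 Corollary 4.7 (pp. 659–660) and §3 p. 654] -/
theorem Polarization.mem_lefschetzSimilitudeGroupBaseChange_prod_self_iff (γ : (K ⊗[ℚ] (V × V)) ≃ₗ[K] (K ⊗[ℚ] (V × V))) :
    γ ∈ (Q.prod Q).lefschetzSimilitudeGroupBaseChange K ↔
      ∃ γ₀ ∈ Q.lefschetzSimilitudeGroupBaseChange K, γ = diagEmbedding K V γ₀ := by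
  rw [Q.lefschetzSimilitudeGroupBaseChange_prod_self_eq_map_diagEmbedding K, Subgroup.mem_map]
  constructor
  · rintro ⟨γ₀, h₀, rfl⟩
    exact ⟨γ₀, h₀, rfl⟩
  · rintro ⟨γ₀, h₀, rfl⟩
    exact ⟨γ₀, h₀, rfl⟩

/-- The multiplier is unchanged along the diagonal: `(Q ⊕ Q)_K((γ ⊕ γ) z, (γ ⊕ γ) z') = ν (Q ⊕ Q)_K(z, z')` iff
`Q_K(γ x, γ y) = ν Q_K(x, y)` ("`l(A^r)` restricts to `l(A)`"). [cite: Milne1999LefschetzClasses, §4 Corollary 4.7 (pp. 659–660)] -/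
theorem Polarization.forall_baseChange_prod_form_diagEmbedding_iff (γ : (K ⊗[ℚ] V) ≃ₗ[K] (K ⊗[ℚ] V)) (ν : K) :
    (∀ z z', (Q.prod Q).form.baseChange K (diagEmbedding K V γ z) (diagEmbedding K V γ z') =
        ν * (Q.prod Q).form.baseChange K z z') ↔
      ∀ x y, Q.form.baseChange K (γ x) (γ y) = ν * Q.form.baseChange K x y := by
  rw [diagEmbedding_apply, Q.forall_baseChange_prod_form_blockDiag_iff Q γ γ ν, and_self_iff]

end Powers

end HodgeStructure

end Literature.AlgebraicGeometry.Motives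

end
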